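import Summits.CriticalPhenomena.PercolationContinuityZ3.Theorems.PercNearOneGluingNoHeavyLowerTailCovTauOfTA
import Summits.CriticalPhenomena.PercolationContinuityZ3.Theorems.PercNearOneGluingNoHeavyLowerTailHullPortMarkerDominanceTools
import Literature.Probability.Percolation.TwoClusterConditionalAssociationProofs
import Literature.Probability.Percolation.TripodExchange
import HarnessLib
import HarnessLib.Audit.Tags

/-!
# The between-world boosts of the single-edge chain rule obey marker dominance: THEOREM (PAPER-2 track (ii): constants of the CSH family)

builds on p205010 (kernel theorem, internal audit signed; external expert review pending).  Support file (`--supports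
stmt-CriticalPhenomena-4575`), seat `prim-consts-2` (gen 7); rows A6/A11 of `run/shared/lean/prim/consts/CONSTANTS.md`; memo
`run/shared/lean/prim/consts/FROM-prim-consts-2-g7-ROW-SPLIT.md` §3, §8.  No definitions, no named facts, no sorries; standard axioms.

Notation `P_x = μ( · | x ↮ Y)`, `Q = μ( · | xu ↮ Y)`.  In the single-edge chain rule CR (`Consts.SingleEdgeChainRule`, OPEN) the first-step gains
decompose as `a₂ − a₁ = Q(o ∈ C_u ∖ C_x) + ε_o`, `b₂ − b₁ = Q(v ∈ C_u ∖ C_x) + ε_v` with the BETWEEN-WORLD BOOSTS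
`ε_t := Q(t ∈ C_x) − P_x(t ∈ C_x) = Cov_{P_x}(1{t ∈ C_x}, 1{u ↮ Y}) / P_x(u ↮ Y) ≥ 0`, and the exact census of the seat shows that CR is the sum
of a "genuine" inequality (false alone) and the between-world inequality `S3: (1 − b₂) ε_o ≥ ε_v (a₃ − a₂)` (true in all instances; memo §3).
This file proves the structural fact behind the between-world terms:

* `Consts.betweenWorld_markerDominance` — **THEOREM**: for `x ≠ v`, with `D = {x ↮ Y}`, `𝒜 = {v ↮ {x} ∪ Y}`,
  `μ(𝒜 ∩ {v↔o}) · [μ(D)·μ(D ∩ {u↮Y} ∩ {x↔v}) − μ(D ∩ {u↮Y})·μ(D ∩ {x↔v})] ≤ μ(𝒜) · [μ(D)·μ(D ∩ {u↮Y} ∩ {x↔o}) − μ(D ∩ {u↮Y})·μ(D ∩ {x↔o})]`,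
  i.e. `ε_o ≥ p · ε_v` with `p = P(o ∈ C_v | v ↮ {x} ∪ Y)` — the between-world boosts satisfy the MARKER DOMINANCE LEMMA MDL(X) of the tree
  (`CovTau.markerDominanceAvoid`, owner `x`, avoided set `Y`, markers `v, o`).  The point: by the tower property
  `Cov_{P_x}(1{t ∈ C_x}, 1{u ↮ Y}) = Cov_{P_x}(1{t ∈ C_x}, F_u(C_x))` for the SHIELDING FUNCTIONAL `F_u(W) := P(u ↮ Y | C_x = W)`
  (`= Σ_η weight(η) 1{u ↮ Y in η ∖ W̄}`), which is a MONOTONE function of the open edge cluster of `x` (a bigger cluster shields `u`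
  from `Y`), so MDL(X) applies to it (`Consts.setIntegral_mul_shield_eq`: `∫_D A(C_x)·1{u↮Y} = ∫_D A(C_x)·F_u(C_x)`, the block-independence
  identity `BHK2006.sum_cond_cluster_sdiff`).  With the conjecture MDLXJoint (`Consts.MDLXJoint`) the constant improves to
  `p′ = P(o ∈ C_v | v ↮ xY, x ↮ Y)`; CR itself would need the (incomparable) single-pair value `p*_o(xu,v)` at this functional (= S3), so
  this theorem does NOT close CR (memo §8: the substitution fails in ≈ 15–40 % of instances) — it identifies the between-world part of CR as a
  marker-dominance phenomenon, exactly as in the proved pendant case (`Consts.chainRule_uAvoid_noTarget`, where `Y` hangs from `u` and MDL(∅) suffices).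
[cite: VandenbergHaggstromKahn2005, Thm. 1.3 (p. 6), §1 pp. 7–8] [cite: Gladkov2024, Thm. 3.2]
-/

noncomputable section

namespace Summit.CriticalPhenomena.PercolationContinuityZ3.Theorems

open MeasureTheory Set Literature.Probability.LatticeModels Literature.Probability.Percolation
open scoped Classical

namespace Consts

open LonePortSum LonePortSumGeneral BHK2006 DecisionTree

variable {V : Type*} [Fintype V]

/-- **The shielding functional is what `1{u ↮ Y}` integrates to, cluster by cluster.**  For the owner `x`, avoided set `Y`, a vertex `u`,
`D = {x ↮ Y}` and ANY function `A` of the open edge cluster of `x`: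
`∫_D A(C_x)·1{u ↮ Y} dμ = ∫_D A(C_x)·F_u(C_x) dμ` with `F_u(W) = Σ_η weight(η)·1{u ↮ Y in η ∖ W̄}` (`W̄` = the pairs meeting `{x} ∪ V(W)`).
On `D`, `1{u ↮ Y}(ω) = 1{u ↮ Y in ω ∖ W̄(C_x ω)}` (if `u ∈ C_x` both sides are `1`; otherwise `C_u` lives off `W̄`), and given `{C_x = W}` the
coordinates off `W̄` are fresh (`BHK2006.sum_cond_cluster_sdiff`). [cite: VandenbergHaggstromKahn2005, §1 pp. 7–8 (display (10))] -/
theorem setIntegral_mul_shield_eq (w : Sym2 V → unitInterval) (x u : V) (Y : Set V) (A : Set (Sym2 V) → ℝ) :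
    ∫ ω in {ω : BondConfig V | ∀ y ∈ Y, ¬ (openGraph ω).Reachable x y},
        A (openEdgeCluster ω x) * ({ω : BondConfig V | ∀ y ∈ Y, ¬ (openGraph ω).Reachable u y}).indicator 1 ω ∂(prodBernoulli w) =
      ∫ ω in {ω : BondConfig V | ∀ y ∈ Y, ¬ (openGraph ω).Reachable x y},
        A (openEdgeCluster ω x) * (∑ η : BondConfig V, weight (fun e => (w e : ℝ)) η *
          ({ζ : BondConfig V | ∀ y ∈ Y, ¬ (openGraph ζ).Reachable u y}).indicator 1
            (η \ {e | ∃ a ∈ e, a = x ∨ ∃ e' ∈ openEdgeCluster ω x, a ∈ e'})) ∂(prodBernoulli w) := by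
  classical
  set D : Set (BondConfig V) := {ω | ∀ y ∈ Y, ¬ (openGraph ω).Reachable x y} with hD
  set Uav : Set (BondConfig V) := {ω | ∀ y ∈ Y, ¬ (openGraph ω).Reachable u y} with hUav
  set H : BondConfig V → ℝ := Uav.indicator 1 with hH
  set w' : Sym2 V → ℝ := fun e => (w e : ℝ) with hw'
  have hm : ∑ ω, weight w' ω = 1 := by
    have h1 := integral_prodBernoulli_eq_sum w fun _ => (1 : ℝ)
    simp only [integral_const, probReal_univ, smul_eq_mul, mul_one] at h1
    exact h1.symm
  -- `1_D = NX(C_x)`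
  set NX : Set (Sym2 V) → ℝ := fun C => if ∀ y ∈ Y, ¬ (y = x ∨ ∃ e ∈ C, y ∈ e) then 1 else 0 with hNX
  have hind : ∀ ω : BondConfig V, ind D ω = NX (openEdgeCluster ω x) := by
    intro ω
    by_cases hω : ω ∈ D
    · have hω' : ∀ y ∈ Y, ¬ (openGraph ω).Reachable x y := hω
      have h1 : ∀ y ∈ Y, ¬ (y = x ∨ ∃ e ∈ openEdgeCluster ω x, y ∈ e) := fun y hy h =>
        hω' y hy ((reachable_iff_exists_mem_openEdgeCluster ω x y).2 h)
      rw [ind_of_mem hω, hNX]; simp only [if_pos h1]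
    · have hω' : ∃ y ∈ Y, (openGraph ω).Reachable x y := by
        by_contra hcon; exact hω fun y hy hr => hcon ⟨y, hy, hr⟩
      obtain ⟨y, hy, hr⟩ := hω'
      have h1 : ¬ ∀ y ∈ Y, ¬ (y = x ∨ ∃ e ∈ openEdgeCluster ω x, y ∈ e) := fun h =>
        h y hy ((reachable_iff_exists_mem_openEdgeCluster ω x y).1 hr)
      rw [ind_of_not_mem hω, hNX]; simp only [if_neg h1]
  -- locality of `H` on `D`
  have hloc : ∀ ω : BondConfig V, ω ∈ D →
      H (ω \ {e | ∃ a ∈ e, a = x ∨ ∃ e' ∈ openEdgeCluster ω x, a ∈ e'}) = H ω := by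
    intro ω hω
    have hωD : ∀ y ∈ Y, ¬ (openGraph ω).Reachable x y := hω
    by_cases hxu : (openGraph ω).Reachable x u
    · -- `u ∈ C_x`: `u ↮ Y` in `ω` (as `x ↮ Y`), and `u` is isolated in `ω ∖ W̄`
      have h1 : ω ∈ Uav := fun y hy huy => hωD y hy (hxu.trans huy)
      have hubar : u = x ∨ ∃ e ∈ openEdgeCluster ω x, u ∈ e := (reachable_iff_exists_mem_openEdgeCluster ω x u).1 hxu
      have h2 : (ω \ {e | ∃ a ∈ e, a = x ∨ ∃ e' ∈ openEdgeCluster ω x, a ∈ e'}) ∈ Uav := by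
        intro y hy huy
        -- a walk from `u` in `ω ∖ W̄` has no first edge
        rw [SimpleGraph.reachable_iff_reflTransGen] at huy
        cases huy.cases_head with
        | inl h => exact hωD y hy (h ▸ hxu)
        | inr h =>
          obtain ⟨b, hub, _⟩ := h
          obtain ⟨hmem, _⟩ := (openGraph_adj _ u b).1 hub
          exact hmem.2 ⟨u, Sym2.mem_mk_left u b, hubar⟩
      rw [hH, indicator_of_mem h1, indicator_of_mem h2]; rfl
    · -- `u ∉ C_x`: the cluster of `u` is the same off `W̄`
      have ht : ¬ (u = x ∨ ∃ e ∈ openEdgeCluster ω x, u ∈ e) := by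
        rw [← reachable_iff_exists_mem_openEdgeCluster]; exact hxu
      have hC := BHK2006.openEdgeCluster_eq_sdiff_bar (ω := ω) (s := x) (t := u) rfl ht
      have hiff : ∀ y, (openGraph (ω \ {e | ∃ a ∈ e, a = x ∨ ∃ e' ∈ openEdgeCluster ω x, a ∈ e'})).Reachable u y ↔
          (openGraph ω).Reachable u y := by
        intro y
        rw [reachable_iff_exists_mem_openEdgeCluster, reachable_iff_exists_mem_openEdgeCluster, ← hC]
      by_cases h1 : ω ∈ Uav
      · have h2 : (ω \ {e | ∃ a ∈ e, a = x ∨ ∃ e' ∈ openEdgeCluster ω x, a ∈ e'}) ∈ Uav :=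
          fun y hy huy => h1 y hy ((hiff y).1 huy)
        rw [hH, indicator_of_mem h1, indicator_of_mem h2]; rfl
      · have h2 : (ω \ {e | ∃ a ∈ e, a = x ∨ ∃ e' ∈ openEdgeCluster ω x, a ∈ e'}) ∉ Uav :=
          fun h => h1 fun y hy huy => h y hy ((hiff y).2 huy)
        rw [hH, indicator_of_notMem h1, indicator_of_notMem h2]
  -- pointwise: `A(C_x) H 1_D = NX(C_x) A(C_x) H(ω ∖ W̄)`
  have hptw : ∀ ω : BondConfig V, A (openEdgeCluster ω x) * H ω * ind D ω =
      NX (openEdgeCluster ω x) * A (openEdgeCluster ω x) *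
        H (ω \ {e | ∃ a ∈ e, a = x ∨ ∃ e' ∈ openEdgeCluster ω x, a ∈ e'}) := by
    intro ω
    rw [hind ω]
    by_cases hω : ω ∈ D
    · rw [hloc ω hω]; ring
    · have h0 : NX (openEdgeCluster ω x) = 0 := by rw [← hind ω, ind_of_not_mem hω]
      rw [h0]; ring
  rw [setIntegral_eq_sum w D, setIntegral_eq_sum w D]
  have e2 := sum_cond_cluster_sdiff w' hm x (fun C ξ => NX C * A C * H ξ)
  have lhs : ∑ ω, weight w' ω * (A (openEdgeCluster ω x) * H ω * ind D ω) =
      ∑ ω, weight w' ω * ((fun C ξ => NX C * A C * H ξ) (openEdgeCluster ω x)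
        (ω \ {e | ∃ a ∈ e, a = x ∨ ∃ e' ∈ openEdgeCluster ω x, a ∈ e'})) :=
    Finset.sum_congr rfl fun ω _ => by simp only; rw [hptw ω]
  rw [lhs, e2]
  refine Finset.sum_congr rfl fun ω _ => ?_
  rw [hind ω]
  simp only [Finset.mul_sum, Finset.sum_mul]
  refine Finset.sum_congr rfl fun η _ => ?_
  ring

/-- **THEOREM — the between-world boosts obey marker dominance.**  For `x ≠ v`, every `u, o` and avoided set `Y`, with `D = {x ↮ Y}`,
`DU = D ∩ {u ↮ Y} = {xu ↮ Y}` and `𝒜 = {v ↮ {x} ∪ Y}`: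
`μ(𝒜 ∩ {v ↔ o}) · [μ(D) μ(DU ∩ {x↔v}) − μ(DU) μ(D ∩ {x↔v})] ≤ μ(𝒜) · [μ(D) μ(DU ∩ {x↔o}) − μ(DU) μ(D ∩ {x↔o})]`,
i.e. `P(o ∈ C_v | v ↮ xY) · ε_v ≤ ε_o` for the between-world boosts `ε_t = Q(t ∈ C_x) − P_x(t ∈ C_x)` of the chain rule.  Proof: the tree's MDL(X)
(`CovTau.markerDominanceAvoid`) for the monotone shielding functional `F_u(W) = P(u ↮ Y | C_x = W)`, whose integrals against `1{x↔t}` on `D` are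
`μ(DU ∩ {x↔t})` (`Consts.setIntegral_mul_shield_eq`). [cite: VandenbergHaggstromKahn2005, Thm. 1.3 (p. 6), §1 pp. 7–8] [cite: Gladkov2024, Thm. 3.2] -/
theorem betweenWorld_markerDominance (w : Sym2 V → unitInterval) (x u v o : V) (Y : Set V) (hxv : x ≠ v) :
    (prodBernoulli w).real ({ω : BondConfig V | ∀ t ∈ insert x Y, ¬ (openGraph ω).Reachable v t} ∩ openConn v o) *
        ((prodBernoulli w).real {ω : BondConfig V | ∀ y ∈ Y, ¬ (openGraph ω).Reachable x y} *
            (prodBernoulli w).real ({ω : BondConfig V | ∀ y ∈ Y, ¬ (openGraph ω).Reachable x y} ∩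
              {ω | ∀ y ∈ Y, ¬ (openGraph ω).Reachable u y} ∩ openConn x v) -
          (prodBernoulli w).real ({ω : BondConfig V | ∀ y ∈ Y, ¬ (openGraph ω).Reachable x y} ∩
              {ω | ∀ y ∈ Y, ¬ (openGraph ω).Reachable u y}) *
            (prodBernoulli w).real ({ω : BondConfig V | ∀ y ∈ Y, ¬ (openGraph ω).Reachable x y} ∩ openConn x v)) ≤
      (prodBernoulli w).real {ω : BondConfig V | ∀ t ∈ insert x Y, ¬ (openGraph ω).Reachable v t} *
        ((prodBernoulli w).real {ω : BondConfig V | ∀ y ∈ Y, ¬ (openGraph ω).Reachable x y} *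
            (prodBernoulli w).real ({ω : BondConfig V | ∀ y ∈ Y, ¬ (openGraph ω).Reachable x y} ∩
              {ω | ∀ y ∈ Y, ¬ (openGraph ω).Reachable u y} ∩ openConn x o) -
          (prodBernoulli w).real ({ω : BondConfig V | ∀ y ∈ Y, ¬ (openGraph ω).Reachable x y} ∩
              {ω | ∀ y ∈ Y, ¬ (openGraph ω).Reachable u y}) *
            (prodBernoulli w).real ({ω : BondConfig V | ∀ y ∈ Y, ¬ (openGraph ω).Reachable x y} ∩ openConn x o)) := by
  classical
  set μ := prodBernoulli w with hμ
  have hmeas : ∀ T : Set (BondConfig V), MeasurableSet T := fun _ => MeasurableSet.of_discrete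
  set D : Set (BondConfig V) := {ω | ∀ y ∈ Y, ¬ (openGraph ω).Reachable x y} with hD
  set Uav : Set (BondConfig V) := {ω | ∀ y ∈ Y, ¬ (openGraph ω).Reachable u y} with hUav
  set w' : Sym2 V → ℝ := fun e => (w e : ℝ) with hw'
  have hw0 : ∀ e, 0 ≤ w' e := fun e => (w e).2.1
  have hw1 : ∀ e, w' e ≤ 1 := fun e => (w e).2.2
  -- the shielding functional
  set bar : Set (Sym2 V) → Set (Sym2 V) := fun W => {e | ∃ a ∈ e, a = x ∨ ∃ e' ∈ W, a ∈ e'} with hbar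
  set F : Set (Sym2 V) → ℝ := fun W => ∑ η : BondConfig V, weight w' η * Uav.indicator 1 (η \ bar W) with hF
  have hHanti : Antitone (Uav.indicator (1 : BondConfig V → ℝ)) := by
    intro ζ ζ' hle
    by_cases h : ζ' ∈ Uav
    · have h' : ζ ∈ Uav := fun y hy hr => h y hy (hr.mono (BHK2006.openGraph_le hle))
      rw [indicator_of_mem h, indicator_of_mem h']; simp
    · rw [indicator_of_notMem h]; exact indicator_nonneg (fun _ _ => zero_le_one) _
  have hFmono : Monotone F := by
    intro W W' hWW'
    refine Finset.sum_le_sum fun η _ => mul_le_mul_of_nonneg_left ?_ (weight_nonneg hw0 hw1 η)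
    exact hHanti (Set.sdiff_subset_sdiff_right (bar_mono x hWW'))
  -- MDL(X) for `F`
  have mdl := CovTau.markerDominanceAvoid w x v o Y hxv F hFmono
  -- the three integrals of `F`
  have hI : ∀ t : V, ∫ ω in D ∩ openConn x t, F (openEdgeCluster ω x) ∂μ = μ.real (D ∩ Uav ∩ openConn x t) := by
    intro t
    have h1 : ∫ ω in D ∩ openConn x t, F (openEdgeCluster ω x) ∂μ =
        ∫ ω in D, connIndicatorFn x t (openEdgeCluster ω x) * F (openEdgeCluster ω x) ∂μ := by
      rw [setIntegral_eq_sum w (D ∩ openConn x t), setIntegral_eq_sum w D]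
      refine Finset.sum_congr rfl fun ω _ => ?_
      rw [connIndicatorFn_openEdgeCluster, ind_inter]
      by_cases h : ω ∈ openConn x t
      · rw [indicator_of_mem h, ind_of_mem h]; simp
      · rw [indicator_of_notMem h, ind_of_not_mem h]; simp
    have h2 := setIntegral_mul_shield_eq w x u Y (connIndicatorFn x t)
    rw [h1, ← h2]
    simp only [connIndicatorFn_openEdgeCluster, TripodExchange.setIntegral_indicator_mul_indicator_eq]
    congr 1; ext ω; simp only [mem_inter_iff]; tauto
  have hI0 : ∫ ω in D, F (openEdgeCluster ω x) ∂μ = μ.real (D ∩ Uav) := by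
    have h2 := setIntegral_mul_shield_eq w x u Y (fun _ => (1 : ℝ))
    simp only [one_mul] at h2
    rw [← h2, TripodExchange.setIntegral_indicator_one_eq]
  rw [hI v, hI o, hI0] at mdl
  exact mdl

end Consts

end Summit.CriticalPhenomena.PercolationContinuityZ3.Theorems

end
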